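import Mathlib
import Literature.RingTheory.CohomologyAnnihilator.Compactness
import Literature.RingTheory.CohomologyAnnihilator.TowerRestrict
import HarnessLib

/-!
# Base change along a free algebra restricts to a copower (`Add`-bookkeeping for descent)

Topic: `Literature/RingTheory/CohomologyAnnihilator`.  In the descent step of the proof of
[IyengarTakahashi2014, Theorem 5.4] the generator `G'` of `mod (K ⊗ₖ A)` is defined over a finite
subextension `l/k`, `G' ≅ (K ⊗ₖ A) ⊗_{l ⊗ₖ A} G_l`, and since `K ⊗ₖ A` is FREE over `l ⊗ₖ A`
(a basis of `K/l`), restriction of scalars turns `G'` into a direct sum of copies of `G_l`: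
"`(M_K)|_A = M^{(I)}`".  In the vocabulary of `Compactness.lean` (`IsRetractOfCopower G X` =
"`X ∈ Add G`"):

* `isRetractOfCopower_restrictScalars_baseChange_of_free` — if `B` is free over `R` with basis
  indexed by `ι`, then for every `R`-module `N`, `(B ⊗_R N)|_R ∈ Add N` (indeed
  `(B ⊗_R N)|_R ≅ N^{(ι)}`, `TensorProduct.finsuppScalarLeft`).
* `IsRetractOfCopower.restrictScalars` — restriction of scalars maps `Add G` into `Add (G|_R)`;
  `IsRetractOfCopower.of_iso` — `Add G` is closed under isomorphism.

These are the `Add`-lemmas behind the hypothesis `hAdd` of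
`strongGenerator_descent_of_generatorDescent` (`StrongGeneratorDescentField.lean`).

## References

* S. B. Iyengar, R. Takahashi, *Annihilation of cohomology and strong generation of module
  categories*, IMRN 2016; arXiv:1404.1476 — proof of Theorem 5.4, §4 (A compactness argument).
  [`IyengarTakahashi2014`]
-/

noncomputable section

open CategoryTheory
open scoped TensorProduct

universe u

namespace Literature.RingTheory.CohomologyAnnihilator

section Iso

variable {A : Type u} [CommRing A]

/-- `Add G` is closed under isomorphism. [cite: IyengarTakahashi2014, §4 (A compactness argument)] -/
theorem IsRetractOfCopower.of_iso {G X X' : ModuleCat.{u} A} (h : IsRetractOfCopower G X)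
    (e : X ≅ X') : IsRetractOfCopower G X' := by
  obtain ⟨ι, i, p, hip⟩ := h
  refine ⟨ι, e.inv ≫ i, p ≫ e.hom, ?_⟩
  rw [Category.assoc, ← Category.assoc i p, hip, Category.id_comp, e.inv_hom_id]

end Iso

section Restrict

variable {R S : Type u} [CommRing R] [CommRing S] [Algebra R S]

/-- `(G^{(ι)})|_R ≅ (G|_R)^{(ι)}` (the identity map). [folklore] -/
private theorem nonempty_restrictScalars_finsupp_iso (G : ModuleCat.{u} S) (ι : Type u) :
    Nonempty ((restrictScalarsFunctor R S).obj (ModuleCat.of S (ι →₀ G)) ≅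
      ModuleCat.of R (ι →₀ (restrictScalarsFunctor R S).obj G)) :=
  letI : Module R (ι →₀ G) :=
    ((restrictScalarsFunctor R S).obj (ModuleCat.of S (ι →₀ G))).isModule
  ⟨LinearEquiv.toModuleIso
    { toFun := fun x => x
      map_add' := fun _ _ => rfl
      map_smul' := fun _ _ => rfl
      invFun := fun x => x
      left_inv := fun _ => rfl
      right_inv := fun _ => rfl }⟩

/-- Restriction of scalars maps `Add G` into `Add (G|_R)`.
[cite: IyengarTakahashi2014, §4 (A compactness argument)] -/
theorem IsRetractOfCopower.restrictScalars {G X : ModuleCat.{u} S} (h : IsRetractOfCopower G X) :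
    IsRetractOfCopower ((restrictScalarsFunctor R S).obj G) ((restrictScalarsFunctor R S).obj X) := by
  obtain ⟨ι, i, p, hip⟩ := h
  obtain ⟨ε⟩ := nonempty_restrictScalars_finsupp_iso (R := R) G ι
  refine ⟨ι, (restrictScalarsFunctor R S).map i ≫ ε.hom, ε.inv ≫ (restrictScalarsFunctor R S).map p,
    ?_⟩
  rw [Category.assoc, ε.hom_inv_id_assoc, ← CategoryTheory.Functor.map_comp, hip,
    CategoryTheory.Functor.map_id]

/-- **Base change along a free algebra is a copower after restriction of scalars**: if `S` is
free over `R` with a basis indexed by `ι`, then `(S ⊗_R N)|_R ∈ Add N` for every `R`-module `N`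
(`(S ⊗_R N)|_R ≅ (R^{(ι)} ⊗_R N)|_R ≅ N^{(ι)}`) — the step "`(M_K)|_A = M^{(I)}`" of the descent in
the proof of Theorem 5.4. [cite: IyengarTakahashi2014, Thm. 5.4 (proof)] -/
theorem isRetractOfCopower_restrictScalars_baseChange_of_free {ι : Type u} (b : Module.Basis ι R S)
    (N : ModuleCat.{u} R) :
    IsRetractOfCopower N ((restrictScalarsFunctor R S).obj (ModuleCat.of S (S ⊗[R] N))) := by
  classical
  -- the `R`-linear identification with the copower, for the natural `R`-structure on `S ⊗_R N`
  let e₀ : S ⊗[R] N ≃ₗ[R] (ι →₀ (N : Type u)) :=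
    (TensorProduct.congr b.repr (LinearEquiv.refl R N)).trans (TensorProduct.finsuppScalarLeft R N ι)
  have hsmul : ∀ (r : R) (x : S ⊗[R] N), algebraMap R S r • x = r • x := fun r x =>
    algebraMap_smul S r x
  have he₀smul : ∀ (r : R) (x : S ⊗[R] N), e₀ (algebraMap R S r • x) = r • e₀ x := fun r x => by
    rw [hsmul, map_smul]
  have he₀symm : ∀ (r : R) (y : ι →₀ (N : Type u)),
      e₀.symm (r • y) = algebraMap R S r • e₀.symm y := fun r y => by
    rw [hsmul, map_smul]
  -- switch to the restricted structure
  letI : Module R (S ⊗[R] N) :=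
    ((restrictScalarsFunctor R S).obj (ModuleCat.of S (S ⊗[R] N))).isModule
  let i : (restrictScalarsFunctor R S).obj (ModuleCat.of S (S ⊗[R] N)) →ₗ[R] (ι →₀ (N : Type u)) :=
    { toFun := fun x => e₀ x
      map_add' := fun x y => map_add e₀ x y
      map_smul' := fun r x => he₀smul r x }
  let p : (ι →₀ (N : Type u)) →ₗ[R] (restrictScalarsFunctor R S).obj (ModuleCat.of S (S ⊗[R] N)) :=
    { toFun := fun y => e₀.symm y
      map_add' := fun x y => map_add e₀.symm x y
      map_smul' := fun r y => he₀symm r y }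
  refine ⟨ι, ModuleCat.ofHom i, ModuleCat.ofHom p, ?_⟩
  refine ModuleCat.hom_ext (LinearMap.ext fun x => ?_)
  change e₀.symm (e₀ x) = x
  exact e₀.symm_apply_apply x

end Restrict

end Literature.RingTheory.CohomologyAnnihilator

end
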